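import Mathlib
import HarnessLib
import Summits.NavierStokesRegularity.NavierStokesRegularity.Theorems.PoloidalWindowDoorLrcModEntireQ4TimeWebFunction

/-!
# Route `PoloidalWindowDoor`, item `LrcModEntire` (stmt-NavierStokesRegularity-20428), cells (Q4-*) of the (TH) column —
# THE SPACE–TIME WEB PACKAGE IS REAL-ANALYTIC, AND THE SHARPENED TIME DICHOTOMY («¬ case I ⇒ every small τ ≠ 0 is non-sonic»)

Cell ns-regularity-ideate, stub-worker seat ns-poloidal-K2-p2 g17 under the LEAD of item 20428 (ns-poloidal-K2-p3 g17; memo T2B-g17 §1: «`U` is real-analytic in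
space–time (class), the maximiser is nondegenerate, so `n₀` and `R` are real-analytic; the set of sonic `τ` is the zero set of an analytic function, hence (I) every
nearby time is sonic or (II) the sonic times are ISOLATED»); `--supports stmt-NavierStokesRegularity-20428 --as helper`.  Tools for the curved END of
`…CaseIIEntrance.caseII_false_of_curvedEnd`:

* `timeSection_analyticAt` — the space–time cross-section family `((τ,s,z),n) ↦ σ·U₂(−1+τ, s·e + n·Je + z·e₂)` is real-analytic for `τ < 1`
  (`…Ancient.analyticOnNhd_uncurry`, the frame map is affine);
* ★ `webFunction_analyticAt` — a maximiser function `n₀` with values in `(−r,r)`, critical along the fibres, over a box `|τ|,|z| < δ ≤ 1/2` on which the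
  cross-sections are strictly concave, is real-analytic: K2-p2 g16's `…CurvedWebTools.contDiffAt_criticalPoint_of_contDiffAt` at smoothness `ω`;
* ★ `ridgeHeight_analyticAt` — hence the ridge height `R(τ,z) = σ·U₂(−1+τ, s·e + n₀·Je + z·e₂)` is jointly real-analytic on the box;
* ★ `eventually_nonsonic` (class-free) — if `τ ↦ R(τ,z)` is analytic on `|τ| < δ` for every `|z| < δ` and NOT every `|τ| < δ′` is sonic for any `δ′ > 0`, then
  for some `δ″ > 0` EVERY `τ` with `0 < |τ| < δ″` is non-sonic (identity theorem for `τ ↦ (δ/2)(R(τ,z) − R(τ,0)) − z(R(τ,δ/2) − R(τ,0))`, no derivatives);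
* ★★ `eventually_nonsonic_of_package` — the class-level corollary from the frame-form (Q4) data on the `δ`-box (exactly hypotheses of the curved END).

WHAT THIS IS NOT: not a claim about Navier–Stokes regularity; tools for the research residue `stub_Q4sonicLineNegIsolated`; nothing is closed; items
20428 / 19708 / 27893 OPEN (bears_on LADDER-NS N0).
-/

noncomputable section

set_option linter.dupNamespace false
set_option linter.style.longLine false

namespace Summit.NavierStokesRegularity.NavierStokesRegularity.Theorems.PoloidalWindowDoorLrcModEntireWebPackageAnalytic

open Set Function Filter Topology Metric
open scoped RealInnerProductSpace InnerProductSpace ContDiff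
open Literature.Analysis Literature.Analysis.FluidPDE Literature.Analysis.UnboundedOperators
open Summit.NavierStokesRegularity.NavierStokesRegularity.Theorems
open Summit.NavierStokesRegularity.NavierStokesRegularity.Theorems.LocalSineTubeDoorProfileAlignedWindowRigidityAncient
open Summit.NavierStokesRegularity.NavierStokesRegularity.Theorems.PoloidalWindowDoorPoloidalWindowRigidityWindow
open Summit.NavierStokesRegularity.NavierStokesRegularity.Theorems.PoloidalWindowDoorLrcModEntireSheetFlattenTools
open Summit.NavierStokesRegularity.NavierStokesRegularity.Theorems.PoloidalWindowDoorLrcModEntireCurvedWebTools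
open Summit.NavierStokesRegularity.NavierStokesRegularity.Theorems.PoloidalWindowDoorLrcModEntireRidgeClassConstants
open Summit.NavierStokesRegularity.NavierStokesRegularity.Theorems.PoloidalWindowDoorLrcModEntireQ4TimeWebFunction

variable {C : ℝ} {U : ℝ → EuclideanSpace ℝ (Fin 3) → EuclideanSpace ℝ (Fin 3)}

/-- **The space–time cross-section family is real-analytic:** `((τ,s,z),n) ↦ σ·U₂(−1+τ, s·e + n·Je + z·e₂)` at every point with `τ < 1`. -/
theorem timeSection_analyticAt (hUrate : HasTypeITimeDecay C U) (hUcont : ContinuousOn (uncurry U) (Iio (0 : ℝ) ×ˢ univ))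
    (hUmild : ∀ s t : ℝ, s < t → t < 0 → ∀ x, U t x = heatExtension (U s) (t - s) x - oseenDuhamel 1 s U U t x)
    (σ : ℝ) (e : EuclideanSpace ℝ (Fin 3)) {p : ℝ × ℝ × ℝ} (hp : p.1 < 1) (n : ℝ) :
    AnalyticAt ℝ (fun v : (ℝ × ℝ × ℝ) × ℝ => σ * U (-1 + v.1.1) (frameCLM e (v.1.2.1, v.2, v.1.2.2)) 2) (p, n) := by
  set A := ((ContinuousLinearMap.fst ℝ ℝ (ℝ × ℝ)).comp (ContinuousLinearMap.fst ℝ (ℝ × ℝ × ℝ) ℝ)).prod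
        ((frameCLM e).comp
          ((((ContinuousLinearMap.fst ℝ ℝ ℝ).comp (ContinuousLinearMap.snd ℝ ℝ (ℝ × ℝ))).comp (ContinuousLinearMap.fst ℝ (ℝ × ℝ × ℝ) ℝ)).prod
            ((ContinuousLinearMap.snd ℝ (ℝ × ℝ × ℝ) ℝ).prod
              (((ContinuousLinearMap.snd ℝ ℝ ℝ).comp (ContinuousLinearMap.snd ℝ ℝ (ℝ × ℝ))).comp (ContinuousLinearMap.fst ℝ (ℝ × ℝ × ℝ) ℝ))))) with hA
  -- the affine frame map `v ↦ (−1 + τ, s·e + n·Je + z·e₂)`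
  have hB : AnalyticAt ℝ (fun v : (ℝ × ℝ × ℝ) × ℝ => A v + (((-1 : ℝ), (0 : EuclideanSpace ℝ (Fin 3))) : ℝ × EuclideanSpace ℝ (Fin 3))) (p, n) :=
    (A.analyticAt _).add analyticAt_const
  have hBfun : (fun v : (ℝ × ℝ × ℝ) × ℝ => A v + (((-1 : ℝ), (0 : EuclideanSpace ℝ (Fin 3))) : ℝ × EuclideanSpace ℝ (Fin 3))) =
      fun v => ((-1 + v.1.1, frameCLM e (v.1.2.1, v.2, v.1.2.2)) : ℝ × EuclideanSpace ℝ (Fin 3)) := by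
    funext v
    rw [hA, timeSection_map_eq, Prod.mk_add_mk, add_zero, add_comm]
  rw [hBfun] at hB
  -- `uncurry U` is analytic at the image point (`−1 + τ < 0`)
  have hUan : AnalyticAt ℝ (uncurry U) ((-1 + p.1, frameCLM e (p.2.1, n, p.2.2)) : ℝ × EuclideanSpace ℝ (Fin 3)) :=
    analyticOnNhd_uncurry hUcont (bdd_of_hasTypeITimeDecay hUrate) hUmild _ (mem_prod.2 ⟨by show -1 + p.1 < 0; linarith, mem_univ _⟩)
  have hcomp : AnalyticAt ℝ (fun v : (ℝ × ℝ × ℝ) × ℝ => uncurry U ((-1 + v.1.1, frameCLM e (v.1.2.1, v.2, v.1.2.2)) : ℝ × EuclideanSpace ℝ (Fin 3))) (p, n) :=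
    hUan.comp_of_eq hB rfl
  have h2 : AnalyticAt ℝ (fun v : (ℝ × ℝ × ℝ) × ℝ => (uncurry U ((-1 + v.1.1, frameCLM e (v.1.2.1, v.2, v.1.2.2)) : ℝ × EuclideanSpace ℝ (Fin 3))) 2) (p, n) :=
    ((EuclideanSpace.proj (𝕜 := ℝ) (2 : Fin 3)).analyticAt _).comp hcomp
  exact analyticAt_const.mul h2

/-- ★ **The web function is real-analytic.**  Over a box `|τ| < δ`, `|z| < δ` (`δ ≤ 1/2`) on which the cross-sections `n ↦ σ·U₂(−1+τ, s·e + n·Je + z·e₂)` are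
strictly concave on `(−r,r)`, any function `n₀` with values in `(−r,r)` that is critical along the fibres is real-analytic (jointly in `(τ,s,z)`). -/
theorem webFunction_analyticAt (hUrate : HasTypeITimeDecay C U) (hUcont : ContinuousOn (uncurry U) (Iio (0 : ℝ) ×ˢ univ))
    (hUmild : ∀ s t : ℝ, s < t → t < 0 → ∀ x, U t x = heatExtension (U s) (t - s) x - oseenDuhamel 1 s U U t x)
    (hUdiv : ∀ t < 0, VectorCalculus.IsDivFree (U t))
    {σ : ℝ} {e : EuclideanSpace ℝ (Fin 3)} {r δ : ℝ} (hδh : δ ≤ 1 / 2)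
    (hconc : ∀ τ z : ℝ, |τ| < δ → |z| < δ → ∀ s : ℝ, ∀ n ∈ Ioo (-r) r,
      fderiv ℝ (fderiv ℝ (fun y => σ * U (-1 + τ) y 2)) (frameCLM e (s, n, z)) (Jvec e) (Jvec e) < 0)
    {n₀ : ℝ × ℝ × ℝ → ℝ} (hn₀ : ∀ q : ℝ × ℝ × ℝ, |q.1| < δ → |q.2.2| < δ → n₀ q ∈ Ioo (-r) r)
    (hcrit : ∀ q : ℝ × ℝ × ℝ, |q.1| < δ → |q.2.2| < δ → fderiv ℝ (fun y => σ * U (-1 + q.1) y 2) (frameCLM e (q.2.1, n₀ q, q.2.2)) (Jvec e) = 0)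
    {q : ℝ × ℝ × ℝ} (hq1 : |q.1| < δ) (hq2 : |q.2.2| < δ) : AnalyticAt ℝ n₀ q := by
  set V : Set (ℝ × ℝ × ℝ) := {q | |q.1| < δ ∧ |q.2.2| < δ} with hV
  have hVo : IsOpen V := (isOpen_lt (continuous_fst.abs) continuous_const).inter
    (isOpen_lt ((continuous_snd.comp continuous_snd).abs) continuous_const)
  set T : Set ℝ := Ioo (-1 / 2 : ℝ) (1 / 2) with hT_def
  have hTo : IsOpen T := isOpen_Ioo
  obtain ⟨F, hF_def⟩ : ∃ F : ℝ → EuclideanSpace ℝ (Fin 3) → ℝ, F = fun τ y => σ * U (-1 + τ) y 2 := ⟨_, rfl⟩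
  have hF : IsSmoothSpaceTimeOn T F := by
    have h := contDiffOn_uncurry_signed hUrate hUcont hUmild hUdiv σ (n := ⊤) (T := T) Subset.rfl
    rw [hF_def]; exact h
  have hT' : ∀ p ∈ V, p.1 ∈ T := fun p hp =>
    ⟨by linarith [(abs_lt.1 hp.1).1], by linarith [(abs_lt.1 hp.1).2]⟩
  -- the cross-section family `G` and its fibre derivatives
  have hGω : ∀ p ∈ V, ∀ n' ∈ Ioo (-r) r, ContDiffAt ℝ ω (fun v : (ℝ × ℝ × ℝ) × ℝ => F v.1.1 (frameCLM e (v.1.2.1, v.2, v.1.2.2))) (p, n') := by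
    intro p hp n' _
    have hp1 : p.1 < 1 := by linarith [(abs_lt.1 hp.1).2]
    have h := timeSection_analyticAt hUrate hUcont hUmild σ e hp1 n'
    rw [hF_def]
    exact h.contDiffAt
  have hconcG : ∀ p ∈ V, ∀ n' ∈ Ioo (-r) r, fderiv ℝ (fderiv ℝ (fun v : (ℝ × ℝ × ℝ) × ℝ => F v.1.1 (frameCLM e (v.1.2.1, v.2, v.1.2.2)))) (p, n')
      ((0 : ℝ × ℝ × ℝ), (1 : ℝ)) ((0 : ℝ × ℝ × ℝ), (1 : ℝ)) < 0 := by
    intro p hp n' hn'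
    rw [fderiv_fderiv_timeSection_fibre hTo hF (hT' p hp) n', hF_def]
    exact hconc p.1 p.2.2 hp.1 hp.2 p.2.1 n' hn'
  have hn₀V : ∀ p ∈ V, n₀ p ∈ Ioo (-r) r := fun p hp => hn₀ p hp.1 hp.2
  have hcritG : ∀ p ∈ V, fderiv ℝ (fun v : (ℝ × ℝ × ℝ) × ℝ => F v.1.1 (frameCLM e (v.1.2.1, v.2, v.1.2.2))) (p, n₀ p) ((0 : ℝ × ℝ × ℝ), (1 : ℝ)) = 0 := by
    intro p hp
    rw [fderiv_timeSection_fibre hTo hF (hT' p hp) (n₀ p), hF_def]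
    exact hcrit p hp.1 hp.2
  have hω : ContDiffAt ℝ ω n₀ q :=
    contDiffAt_criticalPoint_of_contDiffAt hVo (m := ω) (n := ω) (by simp) (by simp) hGω hconcG hn₀V hcritG ⟨hq1, hq2⟩
  exact hω.analyticAt

/-- ★ **The ridge height is jointly real-analytic** on the box: `R(τ,z) = σ·U₂(−1+τ, s·e + n₀(τ,s,z)·Je + z·e₂)` with `n₀` as in `webFunction_analyticAt`. -/
theorem ridgeHeight_analyticAt (hUrate : HasTypeITimeDecay C U) (hUcont : ContinuousOn (uncurry U) (Iio (0 : ℝ) ×ˢ univ))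
    (hUmild : ∀ s t : ℝ, s < t → t < 0 → ∀ x, U t x = heatExtension (U s) (t - s) x - oseenDuhamel 1 s U U t x)
    (hUdiv : ∀ t < 0, VectorCalculus.IsDivFree (U t))
    {σ : ℝ} {e : EuclideanSpace ℝ (Fin 3)} {r δ : ℝ} (hδh : δ ≤ 1 / 2)
    (hconc : ∀ τ z : ℝ, |τ| < δ → |z| < δ → ∀ s : ℝ, ∀ n ∈ Ioo (-r) r,
      fderiv ℝ (fderiv ℝ (fun y => σ * U (-1 + τ) y 2)) (frameCLM e (s, n, z)) (Jvec e) (Jvec e) < 0)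
    {n₀ : ℝ × ℝ × ℝ → ℝ} (hn₀ : ∀ q : ℝ × ℝ × ℝ, |q.1| < δ → |q.2.2| < δ → n₀ q ∈ Ioo (-r) r)
    (hcrit : ∀ q : ℝ × ℝ × ℝ, |q.1| < δ → |q.2.2| < δ → fderiv ℝ (fun y => σ * U (-1 + q.1) y 2) (frameCLM e (q.2.1, n₀ q, q.2.2)) (Jvec e) = 0)
    {R : ℝ → ℝ → ℝ} (hval : ∀ q : ℝ × ℝ × ℝ, |q.1| < δ → |q.2.2| < δ → σ * U (-1 + q.1) (frameCLM e (q.2.1, n₀ q, q.2.2)) 2 = R q.1 q.2.2)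
    {τ z : ℝ} (hτ : |τ| < δ) (hz : |z| < δ) : AnalyticAt ℝ (uncurry R) (τ, z) := by
  -- the analytic map `(τ,z) ↦ ((τ,0,z), n₀(τ,0,z))`
  have hι : AnalyticAt ℝ (fun w : ℝ × ℝ => ((w.1, (0 : ℝ), w.2) : ℝ × ℝ × ℝ)) (τ, z) :=
    analyticAt_fst.prod (analyticAt_const.prod analyticAt_snd)
  have hn : AnalyticAt ℝ (fun w : ℝ × ℝ => n₀ (w.1, (0 : ℝ), w.2)) (τ, z) :=
    (webFunction_analyticAt hUrate hUcont hUmild hUdiv hδh hconc hn₀ hcrit (q := (τ, (0 : ℝ), z)) hτ hz).comp_of_eq hι rfl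
  have hpair : AnalyticAt ℝ (fun w : ℝ × ℝ => (((w.1, (0 : ℝ), w.2), n₀ (w.1, (0 : ℝ), w.2)) : (ℝ × ℝ × ℝ) × ℝ)) (τ, z) := hι.prod hn
  have hG := timeSection_analyticAt hUrate hUcont hUmild σ e (p := (τ, (0 : ℝ), z)) (by show τ < 1; linarith [(abs_lt.1 hτ).2]) (n₀ (τ, (0 : ℝ), z))
  have hcomp := hG.comp_of_eq hpair rfl
  -- it agrees with `uncurry R` near `(τ, z)`
  have hopen : IsOpen {w : ℝ × ℝ | |w.1| < δ ∧ |w.2| < δ} :=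
    (isOpen_lt continuous_fst.abs continuous_const).inter (isOpen_lt continuous_snd.abs continuous_const)
  refine hcomp.congr ?_
  filter_upwards [hopen.mem_nhds (show ((τ, z) : ℝ × ℝ) ∈ {w : ℝ × ℝ | |w.1| < δ ∧ |w.2| < δ} from ⟨hτ, hz⟩)] with ⟨w1, w2⟩ hw
  simp only [Function.comp_apply, uncurry_apply_pair]
  have h := hval (w1, (0 : ℝ), w2) hw.1 hw.2
  simpa using h

/-- ★ **THE SHARPENED TIME DICHOTOMY (class-free).**  If `τ ↦ R(τ,z)` is real-analytic on `|τ| < δ` for every `|z| < δ`, and it is NOT the case that every time of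
some window is sonic (`R(τ,·)` affine on `|z| < δ`), then there is a PUNCTURED window of NON-sonic times: `∃ δ″ > 0, ∀ τ, 0 < |τ| < δ″ → R(τ,·)` is not affine. -/
theorem eventually_nonsonic {R : ℝ → ℝ → ℝ} {δ : ℝ} (hδ : 0 < δ)
    (hRan : ∀ z : ℝ, |z| < δ → ∀ τ : ℝ, |τ| < δ → AnalyticAt ℝ (fun τ' => R τ' z) τ)
    (hiso : ¬ (∃ δ' : ℝ, 0 < δ' ∧ ∀ τ : ℝ, |τ| < δ' → ∃ a b : ℝ, ∀ z : ℝ, |z| < δ → R τ z = a + b * z)) :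
    ∃ δ'' : ℝ, 0 < δ'' ∧ ∀ τ : ℝ, 0 < |τ| → |τ| < δ'' → ¬ (∃ a b : ℝ, ∀ z : ℝ, |z| < δ → R τ z = a + b * z) := by
  by_contra H
  push Not at H
  -- `H : ∀ δ'' > 0, ∃ τ, 0 < |τ| ∧ |τ| < δ'' ∧ (R τ · affine)`: the sonic times accumulate at `0`
  apply hiso
  refine ⟨δ, hδ, fun τ hτ => ?_⟩
  have habs : ∀ {c w : ℝ}, w ∈ Ioo (-c) c ↔ |w| < c := fun {c w} => by rw [mem_Ioo, abs_lt]
  have h0 : |(0 : ℝ)| < δ := by simpa using hδ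
  have hh : |δ / 2| < δ := by rw [abs_of_pos (by linarith)]; linarith
  -- for each height the analytic function `φ_z(τ) := (δ/2)(R τ z − R τ 0) − z (R τ (δ/2) − R τ 0)` vanishes on `(−δ, δ)`
  have hφ : ∀ z : ℝ, |z| < δ → ∀ τ' ∈ Ioo (-δ) δ, δ / 2 * (R τ' z - R τ' 0) - z * (R τ' (δ / 2) - R τ' 0) = 0 := by
    intro z hz
    set φ : ℝ → ℝ := fun τ' => δ / 2 * (R τ' z - R τ' 0) - z * (R τ' (δ / 2) - R τ' 0) with hφ_def
    have hφan : AnalyticOnNhd ℝ φ (Ioo (-δ) δ) := by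
      intro τ' hτ'
      have h1 := hRan z hz τ' (habs.1 hτ')
      have h2 := hRan 0 h0 τ' (habs.1 hτ')
      have h3 := hRan (δ / 2) hh τ' (habs.1 hτ')
      exact (analyticAt_const.mul (h1.sub h2)).sub (analyticAt_const.mul (h3.sub h2))
    -- `φ` vanishes at every sonic time, and those accumulate at `0`
    have hfreq : ∃ᶠ τ' in 𝓝[≠] (0 : ℝ), φ τ' = 0 := by
      rw [(nhdsWithin_hasBasis nhds_basis_ball ({(0 : ℝ)}ᶜ)).frequently_iff]
      intro ε hε
      obtain ⟨τ', hτ'0, hτ'ε, a, b, hab⟩ := H ε hε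
      refine ⟨τ', ⟨by simpa [Real.ball_eq_Ioo, abs_lt] using hτ'ε, by simpa using (abs_pos.1 hτ'0)⟩, ?_⟩
      show δ / 2 * (R τ' z - R τ' 0) - z * (R τ' (δ / 2) - R τ' 0) = 0
      rw [hab z hz, hab 0 h0, hab (δ / 2) hh]
      ring
    have hzero := hφan.eqOn_zero_of_preconnected_of_frequently_eq_zero isPreconnected_Ioo (habs.2 h0) hfreq
    intro τ' hτ'
    exact hzero hτ'
  -- hence `R(τ,·)` is affine on `|z| < δ`
  refine ⟨R τ 0, (R τ (δ / 2) - R τ 0) / (δ / 2), fun z hz => ?_⟩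
  have h := hφ z hz τ (habs.2 hτ)
  have hδ2 : δ / 2 ≠ 0 := by positivity
  field_simp
  linear_combination (2 : ℝ) * h

/-- ★★ **THE SHARPENED TIME DICHOTOMY AT CLASS LEVEL** (exactly the data of the curved END of `…CaseIIEntrance.caseII_false_of_curvedEnd`): class `U`, a box
`|τ|,|z| < δ` (`0 < δ ≤ 1/2`) with strictly concave cross-sections and the web Fermat law in frame form, and the ISOLATION literal ⇒ a punctured window of
non-sonic times. -/
theorem eventually_nonsonic_of_package (hUrate : HasTypeITimeDecay C U) (hUcont : ContinuousOn (uncurry U) (Iio (0 : ℝ) ×ˢ univ))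
    (hUmild : ∀ s t : ℝ, s < t → t < 0 → ∀ x, U t x = heatExtension (U s) (t - s) x - oseenDuhamel 1 s U U t x)
    (hUdiv : ∀ t < 0, VectorCalculus.IsDivFree (U t))
    {σ : ℝ} {e : EuclideanSpace ℝ (Fin 3)} {r δ : ℝ} {R : ℝ → ℝ → ℝ} (hδ : 0 < δ) (hδh : δ ≤ 1 / 2)
    (hconc : ∀ τ z : ℝ, |τ| < δ → |z| < δ → ∀ s : ℝ, ∀ n ∈ Ioo (-r) r,
      fderiv ℝ (fderiv ℝ (fun y => σ * U (-1 + τ) y 2)) (frameCLM e (s, n, z)) (Jvec e) (Jvec e) < 0)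
    (hweb : ∀ τ z : ℝ, |τ| < δ → |z| < δ → ∀ s : ℝ, ∃ n₀ ∈ Ioo (-r) r, σ * U (-1 + τ) (frameCLM e (s, n₀, z)) 2 = R τ z ∧
      ∀ n ∈ Icc (-r) r, n ≠ n₀ → σ * U (-1 + τ) (frameCLM e (s, n, z)) 2 < R τ z)
    (hiso : ¬ (∃ δ' : ℝ, 0 < δ' ∧ ∀ τ : ℝ, |τ| < δ' → ∃ a b : ℝ, ∀ z : ℝ, |z| < δ → R τ z = a + b * z)) :
    ∃ δ'' : ℝ, 0 < δ'' ∧ ∀ τ : ℝ, 0 < |τ| → |τ| < δ'' → ¬ (∃ a b : ℝ, ∀ z : ℝ, |z| < δ → R τ z = a + b * z) := by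
  -- the web function on the whole `δ`-box
  set T : Set ℝ := Ioo (-1 / 2 : ℝ) (1 / 2) with hT_def
  have hTo : IsOpen T := isOpen_Ioo
  obtain ⟨F, hF_def⟩ : ∃ F : ℝ → EuclideanSpace ℝ (Fin 3) → ℝ, F = fun τ y => σ * U (-1 + τ) y 2 := ⟨_, rfl⟩
  have hF : IsSmoothSpaceTimeOn T F := by
    have h := contDiffOn_uncurry_signed hUrate hUcont hUmild hUdiv σ (n := ⊤) (T := T) Subset.rfl
    rw [hF_def]; exact h
  have hδT : Ioo (-δ) δ ⊆ T := fun τ hτ => ⟨by linarith [hτ.1], by linarith [hτ.2]⟩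
  have hconcF : ∀ τ z : ℝ, |τ| < δ → |z| < δ → ∀ s : ℝ, ∀ n ∈ Ioo (-r) r,
      fderiv ℝ (fderiv ℝ (F τ)) (frameCLM e (s, n, z)) (Jvec e) (Jvec e) < 0 := by
    rw [hF_def]; exact hconc
  have hS : ∀ τ z : ℝ, |τ| < δ → |z| < δ → ∀ s : ℝ, ∃ n₀ ∈ Ioo (-r) r, F τ (frameCLM e (s, n₀, z)) = R τ z ∧
      ∀ n ∈ Icc (-r) r, n ≠ n₀ → F τ (frameCLM e (s, n, z)) < R τ z := by
    rw [hF_def]; exact hweb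
  obtain ⟨n₀, hspec, hcrit, -⟩ := exists_timeWebFunction (e := e) hTo hF hδT hconcF hS
  rw [hF_def] at hspec hcrit
  have hRan : ∀ z : ℝ, |z| < δ → ∀ τ : ℝ, |τ| < δ → AnalyticAt ℝ (fun τ' => R τ' z) τ := by
    intro z hz τ hτ
    have h := ridgeHeight_analyticAt hUrate hUcont hUmild hUdiv hδh hconc (fun q h1 h2 => (hspec q h1 h2).1) hcrit
      (R := R) (fun q h1 h2 => (hspec q h1 h2).2.1) hτ hz
    have hline : AnalyticAt ℝ (fun τ' : ℝ => ((τ', z) : ℝ × ℝ)) τ := analyticAt_id.prod analyticAt_const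
    exact h.comp_of_eq hline rfl
  exact eventually_nonsonic hδ hRan hiso

end Summit.NavierStokesRegularity.NavierStokesRegularity.Theorems.PoloidalWindowDoorLrcModEntireWebPackageAnalytic

end
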